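import Mathlib
import HarnessLib

/-!
# The symmetric coset: group theory behind the point count at the Kummer varieties
(cell `hodge-kum4`, seat p2; interface item I8 of HOME/p2/D3-INTERFACE.md)

HONEST FRAMING.  Pure algebra in an arbitrary additive commutative group `A` (intended: `A(ℂ)` for
an abelian surface); nothing here proves the point count `Kum4FixedPointCountAtKummer` or touches
schemes.  The `125` fixed points of the translation `t_u` (`5u = 0`, `u ≠ 0`) on `K⁴(A)` are the
reduced cosets `c + ⟨u⟩` with `5c = σ₀` (Oguiso 2020 Prop. 3.6); the Kummer involution of a datum
is `x ↦ a − x` with `5a = 2σ₀`.  PROVED here, with no finiteness or oddness hypothesis on `A`: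
* `symmetric_coset_iff` — the coset `c + ⟨u⟩` is stable under `x ↦ a − x` iff `2c − a ∈ ⟨u⟩`;
* `exists_symmetric_coset`, `symmetric_coset_unique` — among the cosets `c + ⟨u⟩` with `5c = σ₀`
  there is EXACTLY ONE symmetric one (given one `c₁` with `5c₁ = σ₀` and `5a = 2σ₀`; the inverse of
  `2` on `5`-torsion is `3`);
* `existsUnique_fixed_mem_symmetric_coset` — a symmetric coset with `5u = 0` contains exactly one
  fixed point of `x ↦ a − x` (so it is a configuration "one fixed point + two swapped pairs", the
  generic type of the Kummer fixed fourfold).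
-/

namespace Summit.Ventures.HodgeKum4.KummerPointModel

variable {A : Type*} [AddCommGroup A]

/-- On `5`-torsion, `3` inverts `2`: `2 • 3 • y = y` when `5 • y = 0`. -/
theorem two_nsmul_three_nsmul_eq_self {y : A} (hy : (5 : ℕ) • y = 0) : (2 : ℕ) • (3 : ℕ) • y = y := by
  rw [smul_smul, show (2 : ℕ) * 3 = 5 + 1 by norm_num, add_nsmul, hy, one_nsmul, zero_add]

/-- **Symmetry criterion.**  The coset `c + ⟨u⟩` is stable under the reflection `x ↦ a − x` iff
`2 • c − a ∈ ⟨u⟩`. -/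
theorem symmetric_coset_iff (u a c : A) :
    (∀ x, x - c ∈ AddSubgroup.zmultiples u → (a - x) - c ∈ AddSubgroup.zmultiples u) ↔
      (2 : ℕ) • c - a ∈ AddSubgroup.zmultiples u := by
  constructor
  · intro h
    have h0 := h c (by simp)
    have : (2 : ℕ) • c - a = -((a - c) - c) := by rw [two_nsmul]; abel
    rw [this]
    exact (AddSubgroup.zmultiples u).neg_mem h0
  · intro hc x hx
    have : (a - x) - c = -((2 : ℕ) • c - a) - (x - c) := by rw [two_nsmul]; abel
    rw [this]
    exact (AddSubgroup.zmultiples u).sub_mem ((AddSubgroup.zmultiples u).neg_mem hc) hx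

/-- **Existence of the symmetric coset.**  If `5 • c₁ = σ₀` and `5 • a = 2 • σ₀`, then
`c := c₁ + 3 • (a − 2 • c₁)` satisfies `5 • c = σ₀` and `2 • c − a = 0 ∈ ⟨u⟩`. -/
theorem exists_symmetric_coset (u a σ₀ c₁ : A) (hc₁ : (5 : ℕ) • c₁ = σ₀) (ha : (5 : ℕ) • a = (2 : ℕ) • σ₀) :
    ∃ c, (5 : ℕ) • c = σ₀ ∧ (2 : ℕ) • c - a ∈ AddSubgroup.zmultiples u := by
  have hy : (5 : ℕ) • (a - (2 : ℕ) • c₁) = 0 := by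
    rw [nsmul_sub, ha, smul_smul, show (5 : ℕ) * 2 = 2 * 5 by norm_num, ← smul_smul, hc₁, sub_self]
  refine ⟨c₁ + (3 : ℕ) • (a - (2 : ℕ) • c₁), ?_, ?_⟩
  · rw [nsmul_add, hc₁, smul_smul, show (5 : ℕ) * 3 = 3 * 5 by norm_num, ← smul_smul, hy,
      smul_zero, add_zero]
  · have h : (2 : ℕ) • (c₁ + (3 : ℕ) • (a - (2 : ℕ) • c₁)) - a = 0 := by
      rw [nsmul_add, two_nsmul_three_nsmul_eq_self hy]
      abel
    rw [h]
    exact (AddSubgroup.zmultiples u).zero_mem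

/-- **Uniqueness of the symmetric coset.**  Two symmetric cosets with `5 • c = 5 • c' (= σ₀)`
coincide: `c − c' ∈ ⟨u⟩` (`c − c'` is `5`-torsion with `2 • (c − c') ∈ ⟨u⟩`). -/
theorem symmetric_coset_unique (u a c c' : A) (h5 : (5 : ℕ) • c = (5 : ℕ) • c')
    (hc : (2 : ℕ) • c - a ∈ AddSubgroup.zmultiples u) (hc' : (2 : ℕ) • c' - a ∈ AddSubgroup.zmultiples u) :
    c - c' ∈ AddSubgroup.zmultiples u := by
  have h2 : (2 : ℕ) • (c - c') ∈ AddSubgroup.zmultiples u := by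
    have : (2 : ℕ) • (c - c') = ((2 : ℕ) • c - a) - ((2 : ℕ) • c' - a) := by rw [nsmul_sub]; abel
    rw [this]
    exact (AddSubgroup.zmultiples u).sub_mem hc hc'
  have hy : (5 : ℕ) • (c - c') = 0 := by rw [nsmul_sub, h5, sub_self]
  rw [← two_nsmul_three_nsmul_eq_self hy, smul_comm]
  exact (AddSubgroup.zmultiples u).nsmul_mem h2 _

/-- **The symmetric coset has exactly one fixed point of `x ↦ a − x`** (here `5 • u = 0`): the
configuration `c + ⟨u⟩` is "one fixed point and two swapped pairs". -/
theorem existsUnique_fixed_mem_symmetric_coset (u a c : A) (hu : (5 : ℕ) • u = 0)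
    (hc : (2 : ℕ) • c - a ∈ AddSubgroup.zmultiples u) :
    ∃! x : A, x - c ∈ AddSubgroup.zmultiples u ∧ a - x = x := by
  obtain ⟨m, hm⟩ := AddSubgroup.mem_zmultiples_iff.mp hc
  -- the fixed point: `x₀ = c - 3 m • u` (then `2 x₀ = 2c - 6 m u = 2c - m u = a`)
  have hmu5 : (5 : ℕ) • (m • u) = 0 := by rw [smul_comm, hu, smul_zero]
  refine ⟨c - (3 : ℕ) • (m • u), ⟨?_, ?_⟩, ?_⟩
  · have : c - (3 : ℕ) • (m • u) - c = (-(3 * m)) • u := by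
      rw [neg_smul, mul_zsmul, ← natCast_zsmul (m • u) (3 : ℕ)]
      push_cast
      abel
    rw [this]
    exact AddSubgroup.zsmul_mem_zmultiples u _
  · -- `a - x₀ = x₀ ⟺ 2 x₀ = a`
    have h2 : (2 : ℕ) • (c - (3 : ℕ) • (m • u)) = a := by
      rw [nsmul_sub, two_nsmul_three_nsmul_eq_self hmu5, hm]
      abel
    have : a = (c - (3 : ℕ) • (m • u)) + (c - (3 : ℕ) • (m • u)) := by rw [← two_nsmul, h2]
    rw [this, add_sub_cancel_right]
  · rintro x ⟨hx, hfix⟩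
    -- `x - x₀` is in `⟨u⟩`-span... : from `2x = a = 2x₀` and `x - x₀ ∈ ⟨u⟩`, `5(x - x₀)`? we use:
    -- `2 • (x - x₀) = 0` and `x - x₀ = k • u` with `5 • u = 0` ⇒ `x - x₀ = 6(x-x₀) - 5(x-x₀) = 0`.
    have h2x : (2 : ℕ) • x = a := by rw [two_nsmul]; nth_rewrite 1 [← hfix]; abel
    have h2x₀ : (2 : ℕ) • (c - (3 : ℕ) • (m • u)) = a := by
      rw [nsmul_sub, two_nsmul_three_nsmul_eq_self hmu5, hm]
      abel
    have hd : x - (c - (3 : ℕ) • (m • u)) ∈ AddSubgroup.zmultiples u := by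
      have : x - (c - (3 : ℕ) • (m • u)) = (x - c) + (3 : ℕ) • (m • u) := by abel
      rw [this]
      exact (AddSubgroup.zmultiples u).add_mem hx
        ((AddSubgroup.zmultiples u).nsmul_mem (AddSubgroup.zsmul_mem_zmultiples u m) _)
    obtain ⟨k, hk⟩ := AddSubgroup.mem_zmultiples_iff.mp hd
    have h5d : (5 : ℕ) • (x - (c - (3 : ℕ) • (m • u))) = 0 := by
      rw [← hk, smul_comm, hu, smul_zero]
    have h2d : (2 : ℕ) • (x - (c - (3 : ℕ) • (m • u))) = 0 := by rw [nsmul_sub, h2x, h2x₀, sub_self]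
    have : x - (c - (3 : ℕ) • (m • u)) = 0 := by
      rw [← two_nsmul_three_nsmul_eq_self h5d, smul_comm, h2d, smul_zero]
    exact sub_eq_zero.mp this

end Summit.Ventures.HodgeKum4.KummerPointModel
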